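import Mathlib
import Summits.Schanuel.Schanuel.Theorems.RigidCoreMinimalCounterexampleInAclNoFullLineSlice
import Summits.Schanuel.Schanuel.Theorems.RigidCoreMinimalCounterexampleInAclCosetLineDensityZero
import Summits.Schanuel.Schanuel.Theorems.RigidCoreMinimalCounterexampleInAclLineFamilyProjFibreFinite
import Literature.FieldTheory.TranscendenceDegree.AlgebraicDependenceBookkeeping

/-!
# Coset-line sparsity in the curve case — crux stmt-Schanuel-0969 `RigidCore.MinimalCounterexampleInAcl`

Line `kernel-arithmetic-selection`, registered stub `stub_cosetLineSparsity_curve` (`--supports stmt-Schanuel-0969`):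
the CURVE CASE of the coset-line sparsity statement to which the analytic stub S7b reduces, in any ambient
dimension.

Let `q : ℤ → ℂ^ι` be a coset family along `J ⊆ ℤ`: for `j ∈ J` the tuple `q_j` is ℚ-linearly independent with
`q_j i₀ = c + 2πij`, every exponential fibre `{j ∈ J : e^{q_j} = ω}` is finite, and all points
`P_j = (q_j, e^{q_j}) ∈ ℂ^ι × ℂ^ι`, `j ∈ J`, have the same type as `P_{j₀}` over a field of constants `K = ℚ(ev)`.
If every coordinate of `P_{j₀}` is algebraic over `K[w]` for (at most) one coordinate `w` of `P_{j₀}`, then `J` has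
upper Banach density zero.

Proof.
* Shared `K`-relations (`mem_kLocus_adjoin_of_relations`): `P_j` and `P_{j₀}` satisfy the same `K`-polynomial
  relations, so a coordinate algebraic over `K` takes finitely many values along `J` (roots of one polynomial,
  `finite_image_coord_of_relations`).  Hence, for `J` infinite, `v₀ = q_{j₀} i₀` is transcendental over `K`
  (`j ↦ c + 2πij` is injective) and some `y₁ = e^{q_{j₀} i₁}`, `i₁ ≠ i₀`, is transcendental over `K` (otherwise
  `e^{q_j}` ranges in a finite set of patterns, as `e^{q_j i₀} = e^c`, and `J` is a finite union of finite fibres).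
* Exchange (`isAlgebraic_exchange`, `isAlgebraic_adjoin_of_isAlgebraic_singleton`): `v₀` is algebraic over
  `K[y₁]`, i.e. `p̃(v₀, y₁) = 0` for a non-zero `p̃ ∈ K[Y][X]`; the relation transfers to `p̃(q_j i₀, e^{q_j i₁}) = 0`
  for `j ∈ J`.  On a level set `{e^{q_j i₁} = ω}` the value `ω` has the type of `y₁`, so is transcendental over `K`,
  `p̃(X, ω) ≠ 0` and the injective `j ↦ q_j i₀` takes finitely many values: the level sets are finite.
* Projection to the coordinates `(i₀, i₁)`: the projected family consists of ℚ-linearly independent exponential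
  points of the `K`-locus `W ⊆ ℂ² × ℂ²` of the projection of `P_{j₀}`, a Zariski closed set of dimension `≤ 1`
  (`zariskiDim_kLocus_le_one`), fibre-finite by the previous step; P1 (`stub_cosetLine_densityZero_corankOne`)
  gives density zero of its coset hits, which contain `J`.

References: status note `Cruxes/MinimalCounterexampleInAcl/Lines/kernel_arithmetic_selection.md`; H. Matsumura,
*Commutative Ring Theory*, CUP 1986, Thm 5.6.
-/

noncomputable section

set_option linter.dupNamespace false

open Complex Set

namespace Summit.Schanuel.Schanuel.Cruxes.MinimalCounterexampleInAcl.KernelArithmeticSelection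

open Literature.NumberTheory.Transcendental (IsZariskiClosed zariskiDim indepExpPoints)
open Literature.FieldTheory.TranscendenceDegree

/-- The `K`-locus of a point (local notation, as in Theorems/…NoFullLineSlice). [folklore] -/
local notation3 "kLocus[" K ", " P "]" =>
  MvPolynomial.zeroLocus ℂ (RingHom.ker (MvPolynomial.aeval (R := K) (S₁ := ℂ) P))

/-! ## Transfer of algebraicity along shared `K`-relations

(`aeval_polynomial_aeval_X` — evaluating `p(X_v)` at `P` gives `p(P v)` — is imported from
Theorems/…LineFamilyProjFibreFinite.) -/

section Relations

variable {σ : Type} {K : Type} [Field K] [Algebra K ℂ]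

/-- Algebraicity over `K` of a coordinate is transferred along shared `K`-relations. [folklore] -/
theorem isAlgebraic_coord_of_relations {P P' : σ → ℂ}
    (h : ∀ G : MvPolynomial σ K, MvPolynomial.aeval P G = 0 → MvPolynomial.aeval P' G = 0) {v : σ}
    (halg : IsAlgebraic K (P v)) : IsAlgebraic K (P' v) := by
  obtain ⟨p, hp0, hp⟩ := halg
  refine ⟨p, hp0, ?_⟩
  rw [← aeval_polynomial_aeval_X]
  exact h _ (by rw [aeval_polynomial_aeval_X, hp])

/-- A coordinate algebraic over `K` takes finitely many values along a family sharing the `K`-relations of `P`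
(they are roots of one non-zero polynomial). [folklore] -/
theorem finite_image_coord_of_relations {α : Type} {S : Set α} {P : σ → ℂ} {F : α → σ → ℂ}
    (h : ∀ a ∈ S, ∀ G : MvPolynomial σ K, MvPolynomial.aeval P G = 0 → MvPolynomial.aeval (F a) G = 0)
    {v : σ} (halg : IsAlgebraic K (P v)) : Set.Finite ((fun a => F a v) '' S) := by
  obtain ⟨p, hp0, hp⟩ := halg
  have hp0' : p.map (algebraMap K ℂ) ≠ 0 :=
    (Polynomial.map_ne_zero_iff (algebraMap K ℂ).injective).2 hp0
  refine (Polynomial.finite_setOf_isRoot hp0').subset ?_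
  rintro _ ⟨a, ha, rfl⟩
  rw [Set.mem_setOf_eq, Polynomial.IsRoot.def, Polynomial.eval_map, ← Polynomial.aeval_def,
    ← aeval_polynomial_aeval_X]
  exact h a ha _ (by rw [aeval_polynomial_aeval_X, hp])

end Relations

/-! ## Two-variable relations over `K` -/

section Bivariate

variable {K : Type} [Field K] [Algebra K ℂ]

/-- An element `v` algebraic over `K[y]` satisfies a relation `p̃(v, y) = 0` with `0 ≠ p̃ ∈ K[Y][X]`
(lift the coefficients along `K[Y] ↠ K[y]`). [folklore] -/
theorem exists_bivariate_of_isAlgebraic_adjoin {y v : ℂ}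
    (h : IsAlgebraic (Algebra.adjoin K ({y} : Set ℂ)) v) :
    ∃ pt : Polynomial (Polynomial K), pt ≠ 0 ∧
      pt.eval₂ (Polynomial.aeval y : Polynomial K →ₐ[K] ℂ).toRingHom v = 0 := by
  obtain ⟨p, hp0, hpv⟩ := h
  have hy : y ∈ Algebra.adjoin K ({y} : Set ℂ) := Algebra.self_mem_adjoin_singleton K y
  set φ : Polynomial K →ₐ[K] Algebra.adjoin K ({y} : Set ℂ) :=
    Polynomial.aeval (⟨y, hy⟩ : Algebra.adjoin K ({y} : Set ℂ)) with hφdef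
  have hφv : ∀ r : Polynomial K, ((φ r : Algebra.adjoin K ({y} : Set ℂ)) : ℂ) = Polynomial.aeval y r :=
    fun r => (Polynomial.aeval_algHom_apply (Algebra.adjoin K ({y} : Set ℂ)).val
      (⟨y, hy⟩ : Algebra.adjoin K ({y} : Set ℂ)) r).symm
  have hφ : Function.Surjective φ := by
    rintro ⟨a, ha⟩
    have ha' : a ∈ (Polynomial.aeval y : Polynomial K →ₐ[K] ℂ).range := by
      rw [← Algebra.adjoin_singleton_eq_range_aeval]; exact ha
    obtain ⟨r, hr⟩ := (AlgHom.mem_range _).1 ha'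
    exact ⟨r, Subtype.ext ((hφv r).trans hr)⟩
  obtain ⟨pt, hpt⟩ := Polynomial.map_surjective φ.toRingHom hφ p
  refine ⟨pt, ?_, ?_⟩
  · rintro rfl
    rw [Polynomial.map_zero] at hpt
    exact hp0 hpt.symm
  · have hcomp : (algebraMap (Algebra.adjoin K ({y} : Set ℂ)) ℂ).comp φ.toRingHom =
        (Polynomial.aeval y : Polynomial K →ₐ[K] ℂ).toRingHom :=
      RingHom.ext fun r => hφv r
    rw [← hpt, Polynomial.aeval_def, Polynomial.eval₂_map, hcomp] at hpv
    exact hpv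

/-- At a value `ω` transcendental over `K`, a non-zero `p̃ ∈ K[Y][X]` specialises to a non-zero `p̃(X, ω) ∈ ℂ[X]`,
which has finitely many roots. [folklore] -/
theorem finite_roots_eval₂_of_transcendental {pt : Polynomial (Polynomial K)} (hpt : pt ≠ 0) {ω : ℂ}
    (hω : Transcendental K ω) :
    Set.Finite {z : ℂ | pt.eval₂ (Polynomial.aeval ω : Polynomial K →ₐ[K] ℂ).toRingHom z = 0} := by
  have hinj : Function.Injective (Polynomial.aeval ω : Polynomial K →ₐ[K] ℂ).toRingHom :=
    fun a b hab => transcendental_iff_injective.1 hω hab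
  have hne : pt.map (Polynomial.aeval ω : Polynomial K →ₐ[K] ℂ).toRingHom ≠ 0 :=
    (Polynomial.map_ne_zero_iff hinj).2 hpt
  refine (Polynomial.finite_setOf_isRoot hne).subset fun z hz => ?_
  rw [Set.mem_setOf_eq, Polynomial.IsRoot.def, Polynomial.eval_map]
  exact hz

/-- The two-variable relation `p̃(X_u, X_w) ∈ K[X_σ]` evaluates at `z` to `p̃(z u, z w)`. [folklore] -/
theorem aeval_bivariate {σ : Type} (pt : Polynomial (Polynomial K)) (u w : σ) (z : σ → ℂ) :
    MvPolynomial.aeval z (pt.eval₂ (Polynomial.aeval (MvPolynomial.X w : MvPolynomial σ K) :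
        Polynomial K →ₐ[K] MvPolynomial σ K).toRingHom (MvPolynomial.X u)) =
      pt.eval₂ (Polynomial.aeval (z w) : Polynomial K →ₐ[K] ℂ).toRingHom (z u) := by
  induction pt using Polynomial.induction_on' with
  | add p q hp hq => rw [Polynomial.eval₂_add, Polynomial.eval₂_add, map_add, hp, hq]
  | monomial n r =>
    rw [Polynomial.eval₂_monomial, Polynomial.eval₂_monomial, map_mul, map_pow, MvPolynomial.aeval_X]
    exact congrArg (· * z u ^ n) (aeval_polynomial_aeval_X z w r)

end Bivariate

/-! ## Upper Banach density zero -/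

/-- A finite set of integers has upper Banach density zero (window-count form). [folklore] -/
theorem densityZero_of_finite {J : Set ℤ} (hJ : J.Finite) (δ : ℝ) (hδ : 0 < δ) :
    ∃ N₀ : ℕ, ∀ N : ℕ, N₀ ≤ N → ∀ a : ℤ,
      (Set.ncard {j : ℤ | j ∈ Finset.Ico a (a + (N : ℤ)) ∧ j ∈ J} : ℝ) < δ * (N : ℝ) := by
  obtain ⟨N₀, hN₀⟩ := exists_nat_gt ((J.ncard : ℝ) / δ)
  refine ⟨N₀, fun N hN a => ?_⟩
  have hsub : {j : ℤ | j ∈ Finset.Ico a (a + (N : ℤ)) ∧ j ∈ J} ⊆ J := fun j hj => hj.2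
  have h1 : (Set.ncard {j : ℤ | j ∈ Finset.Ico a (a + (N : ℤ)) ∧ j ∈ J} : ℝ) ≤ J.ncard := by
    exact_mod_cast Set.ncard_le_ncard hsub hJ
  rw [div_lt_iff₀ hδ] at hN₀
  have hN' : (N₀ : ℝ) ≤ N := by exact_mod_cast hN
  nlinarith [mul_le_mul_of_nonneg_left hN' hδ.le]

/-! ## The curve case over a field of constants -/

/-- **Coset-line sparsity in the curve case, over an abstract field of constants `K`.**  A fibre-finite coset family
`q` along `J` whose points `P_j = (q_j, e^{q_j})` share the `K`-relations of `P_{j₀}`, all of whose coordinates are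
algebraic over `K[w]` for one `w ∈ ℂ`, has `J` of upper Banach density zero (shared relations, exchange, finite
level sets, projection to two coordinates and P1; see the module docstring). [folklore] -/
theorem densityZero_of_kRelations {ι : Type} [Fintype ι] {K : Type} [Field K] [Algebra K ℂ]
    (i₀ : ι) (c : ℂ) (J : Set ℤ) (q : ℤ → ι → ℂ)
    (hq : ∀ j ∈ J, LinearIndependent ℚ (q j) ∧ q j i₀ = c + 2 * ↑Real.pi * Complex.I * (j : ℂ))
    (hfib : ∀ ω : ι → ℂ, Set.Finite {j : ℤ | j ∈ J ∧ Complex.exp ∘ q j = ω})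
    {j₀ : ℤ} (w : ℂ)
    (hrel : ∀ j ∈ J, ∀ G : MvPolynomial (ι ⊕ ι) K,
      MvPolynomial.aeval (Sum.elim (q j₀) (Complex.exp ∘ q j₀)) G = 0 ↔
        MvPolynomial.aeval (Sum.elim (q j) (Complex.exp ∘ q j)) G = 0)
    (halg : ∀ v : ι ⊕ ι,
      IsAlgebraic (Algebra.adjoin K ({w} : Set ℂ)) (Sum.elim (q j₀) (Complex.exp ∘ q j₀) v))
    (δ : ℝ) (hδ : 0 < δ) :
    ∃ N₀ : ℕ, ∀ N : ℕ, N₀ ≤ N → ∀ a : ℤ,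
      (Set.ncard {j : ℤ | j ∈ Finset.Ico a (a + (N : ℤ)) ∧ j ∈ J} : ℝ) < δ * (N : ℝ) := by
  classical
  -- ### Step 0: finite families
  by_cases hJfin : J.Finite
  · exact densityZero_of_finite hJfin δ hδ
  have h2πi : (2 * ↑Real.pi * I : ℂ) ≠ 0 := by simp [Real.pi_ne_zero, I_ne_zero]
  set P : ℤ → ι ⊕ ι → ℂ := fun j => Sum.elim (q j) (cexp ∘ q j) with hP
  have hinj : Set.InjOn (fun j => q j i₀) J := by
    intro j hj j' hj' h
    have h' : c + 2 * ↑Real.pi * I * (j : ℂ) = c + 2 * ↑Real.pi * I * (j' : ℂ) := by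
      rw [← (hq j hj).2, ← (hq j' hj').2]; exact h
    exact_mod_cast mul_left_cancel₀ h2πi (add_left_cancel h')
  -- ### Step 1: shared `K`-relations (one direction, in the `P`-notation)
  have hrel' : ∀ j ∈ J, ∀ G : MvPolynomial (ι ⊕ ι) K,
      MvPolynomial.aeval (P j₀) G = 0 → MvPolynomial.aeval (P j) G = 0 :=
    fun j hj G => (hrel j hj G).1
  -- ### Step 2a: the moving coordinate `v₀ = q j₀ i₀` is transcendental over `K`
  have h2a : Transcendental K (q j₀ i₀) := fun halg0 =>
    hJfin ((finite_image_coord_of_relations hrel' (v := Sum.inl i₀) halg0).of_finite_image hinj)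
  -- ### Step 2b: a transcendental exponential coordinate `y₁ = e^{q j₀ i₁}`, `i₁ ≠ i₀`
  obtain ⟨i₁, hi₁, hy₁⟩ : ∃ i₁, i₁ ≠ i₀ ∧ Transcendental K (cexp (q j₀ i₁)) := by
    by_contra hcon
    refine hJfin ?_
    have hF : ∀ i, Set.Finite ((fun j => cexp (q j i)) '' J) := by
      intro i
      by_cases hi : i = i₀
      · refine (Set.finite_singleton (cexp c)).subset ?_
        rintro _ ⟨j, hj, rfl⟩
        simp only [Set.mem_singleton_iff]
        rw [hi, (hq j hj).2, Complex.exp_add, mul_comm (2 * ↑Real.pi * I) (j : ℂ),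
          Complex.exp_int_mul_two_pi_mul_I, mul_one]
      · have halgi : IsAlgebraic K (P j₀ (Sum.inr i)) := by
          by_contra htr
          exact hcon ⟨i, hi, htr⟩
        exact finite_image_coord_of_relations hrel' halgi
    refine ((Set.Finite.pi hF).biUnion fun ω _ => hfib ω).subset fun j hj => ?_
    exact Set.mem_iUnion₂_of_mem (Set.mem_univ_pi.2 fun i => ⟨j, hj, rfl⟩) ⟨hj, rfl⟩
  -- ### Step 3: exchange — `v₀` is algebraic over `K[y₁]`
  have hv₀ : IsAlgebraic (Algebra.adjoin K ({cexp (q j₀ i₁)} : Set ℂ)) (q j₀ i₀) := by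
    have hw : IsAlgebraic (Algebra.adjoin K ({cexp (q j₀ i₁)} : Set ℂ)) w :=
      isAlgebraic_exchange (halg (Sum.inr i₁)) hy₁
    exact isAlgebraic_adjoin_of_isAlgebraic_singleton hw (halg (Sum.inl i₀))
  -- ### Step 4: the level sets of `j ↦ e^{q_j i₁}` on `J` are finite
  obtain ⟨pt, hpt0, hptv⟩ := exists_bivariate_of_isAlgebraic_adjoin hv₀
  have hptJ : ∀ j ∈ J,
      pt.eval₂ (Polynomial.aeval (cexp (q j i₁)) : Polynomial K →ₐ[K] ℂ).toRingHom (q j i₀) = 0 := by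
    intro j hj
    have h := hrel' j hj (pt.eval₂ (Polynomial.aeval (MvPolynomial.X (Sum.inr i₁) : MvPolynomial (ι ⊕ ι) K) :
      Polynomial K →ₐ[K] MvPolynomial (ι ⊕ ι) K).toRingHom (MvPolynomial.X (Sum.inl i₀)))
    rw [aeval_bivariate, aeval_bivariate] at h
    exact h hptv
  have hlevel : ∀ ω : ℂ, Set.Finite {j : ℤ | j ∈ J ∧ cexp (q j i₁) = ω} := by
    intro ω
    by_contra hinf
    obtain ⟨j₁, hj₁J, hj₁ω⟩ := Set.Infinite.nonempty hinf
    have hω : Transcendental K ω := by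
      intro hωalg
      refine hy₁ ?_
      rw [← hj₁ω] at hωalg
      exact isAlgebraic_coord_of_relations (fun G hG => (hrel j₁ hj₁J G).2 hG) (v := Sum.inr i₁) hωalg
    have himg : ((fun j => q j i₀) '' {j : ℤ | j ∈ J ∧ cexp (q j i₁) = ω}).Finite := by
      refine (finite_roots_eval₂_of_transcendental hpt0 hω).subset ?_
      rintro _ ⟨j, ⟨hjJ, hjω⟩, rfl⟩
      simp only [Set.mem_setOf_eq]
      rw [← hjω]
      exact hptJ j hjJ
    exact hinf (himg.of_finite_image (hinj.mono fun j hj => hj.1))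
  -- ### Step 5: projection to the coordinates `(i₀, i₁)` and P1
  have he₂inj : Function.Injective (![i₀, i₁] : Fin 2 → ι) := by
    intro a b hab
    fin_cases a <;> fin_cases b
    · rfl
    · exact absurd hab hi₁.symm
    · exact absurd hab hi₁
    · rfl
  set q' : ℤ → Fin 2 → ℂ := fun j s => q j ((![i₀, i₁] : Fin 2 → ι) s) with hq'
  have hP' : ∀ j, (Sum.elim (q' j) (cexp ∘ q' j) : Fin 2 ⊕ Fin 2 → ℂ) =
      P j ∘ Sum.map (![i₀, i₁] : Fin 2 → ι) (![i₀, i₁] : Fin 2 → ι) := by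
    intro j; funext s; rcases s with s | s <;> rfl
  have hWdim : zariskiDim ℂ (kLocus[K, Sum.elim (q' j₀) (cexp ∘ q' j₀)]) < 2 := by
    refine lt_of_le_of_lt (zariskiDim_kLocus_le_one w fun s => ?_) (by decide)
    rcases s with s | s
    · exact halg (Sum.inl _)
    · exact halg (Sum.inr _)
  have hQW : q' '' J ⊆ indepExpPoints (kLocus[K, Sum.elim (q' j₀) (cexp ∘ q' j₀)]) := by
    rintro _ ⟨j, hj, rfl⟩
    refine ⟨(hq j hj).1.comp (![i₀, i₁] : Fin 2 → ι) he₂inj, mem_kLocus_iff.2 fun G hG => ?_⟩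
    rw [hP', ← MvPolynomial.aeval_rename] at hG ⊢
    exact hrel' j hj _ hG
  have hQfib : ∀ ω : Fin 2 → ℂ, Set.Finite {p : Fin 2 → ℂ | p ∈ q' '' J ∧ cexp ∘ p = ω} := by
    intro ω
    refine ((hlevel (ω 1)).image q').subset ?_
    rintro _ ⟨⟨j, hj, rfl⟩, hω⟩
    refine ⟨j, ⟨hj, ?_⟩, rfl⟩
    have h1 := congrFun hω 1
    simpa [hq'] using h1
  obtain ⟨N₀, hN₀⟩ := stub_cosetLine_densityZero_corankOne _ (q' '' J) c isZariskiClosed_kLocus hWdim hQW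
    hQfib δ hδ
  refine ⟨N₀, fun N hN a => lt_of_le_of_lt ?_ (hN₀ N hN a)⟩
  have hfin : Set.Finite {j : ℤ | j ∈ Finset.Ico a (a + (N : ℤ)) ∧
      ∃ x ∈ q' '' J, x 0 = c + 2 * ↑Real.pi * I * (j : ℂ)} :=
    (Finset.Ico a (a + (N : ℤ))).finite_toSet.subset fun j hj => hj.1
  have hsub : {j : ℤ | j ∈ Finset.Ico a (a + (N : ℤ)) ∧ j ∈ J} ⊆ {j : ℤ | j ∈ Finset.Ico a (a + (N : ℤ)) ∧
      ∃ x ∈ q' '' J, x 0 = c + 2 * ↑Real.pi * I * (j : ℂ)} :=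
    fun j hj => ⟨hj.1, q' j, ⟨j, hj.2, rfl⟩, (hq j hj.2).2⟩
  exact_mod_cast Set.ncard_le_ncard hsub hfin

/-! ## The registered stub -/

/-- **Stub `stub_cosetLineSparsity_curve` — COSET-LINE SPARSITY IN THE CURVE CASE (PROVED).**  A fibre-finite coset
family of ℚ-linearly independent tuples `q_j`, `q_j i₀ = c + 2πij` (`j ∈ J`), whose points `(q_j, e^{q_j})` have one
type over a field of constants `ℚ(ev)` and whose coordinates are algebraic over `ℚ(ev)[w]` for at most one coordinate
`w`, has `J` of upper Banach density zero. [folklore] -/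
theorem stub_cosetLineSparsity_curve : ∀ (ι : Type) [Fintype ι] (i₀ : ι) (c : ℂ) (J : Set ℤ) (q : ℤ → ι → ℂ), (∀ j ∈ J, LinearIndependent ℚ (q j) ∧ q j i₀ = c + 2 * ↑Real.pi * Complex.I * (j : ℂ)) → (∀ ω : ι → ℂ, Set.Finite {j : ℤ | j ∈ J ∧ Complex.exp ∘ q j = ω}) → (∃ (κ : Type) (ev : κ → ℂ) (j₀ : ℤ) (T : Finset (ι ⊕ ι)), j₀ ∈ J ∧ T.card ≤ 1 ∧ (∀ j ∈ J, ∀ H : MvPolynomial (κ ⊕ (ι ⊕ ι)) ℚ, MvPolynomial.aeval (Sum.elim ev (Sum.elim (q j₀) (Complex.exp ∘ q j₀))) H = 0 ↔ MvPolynomial.aeval (Sum.elim ev (Sum.elim (q j) (Complex.exp ∘ q j))) H = 0) ∧ (∀ v : ι ⊕ ι, IsAlgebraic ↥(Algebra.adjoin ↥(IntermediateField.adjoin ℚ (Set.range ev)) ((Sum.elim (q j₀) (Complex.exp ∘ q j₀)) '' (↑T : Set (ι ⊕ ι)))) (Sum.elim (q j₀) (Complex.exp ∘ q j₀) v))) →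 ∀ δ : ℝ, 0 < δ → ∃ N₀ : ℕ, ∀ N : ℕ, N₀ ≤ N → ∀ a : ℤ, (Set.ncard {j : ℤ | j ∈ Finset.Ico a (a + (N : ℤ)) ∧ j ∈ J} : ℝ) < δ * (N : ℝ) := by
  intro ι _ i₀ c J q hq hfib hcurve δ hδ
  obtain ⟨κ, ev, j₀, T, -, hT, hiff, halg⟩ := hcurve
  haveI : Nonempty (ι ⊕ ι) := ⟨Sum.inl i₀⟩
  obtain ⟨vstar, hTsub⟩ := Finset.card_le_one_iff_subset_singleton.1 hT
  refine densityZero_of_kRelations (K := IntermediateField.adjoin ℚ (Set.range ev)) i₀ c J q hq hfib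
    (j₀ := j₀) (Sum.elim (q j₀) (Complex.exp ∘ q j₀) vstar) (fun j hj G => ⟨fun hG => ?_, fun hG => ?_⟩)
    (fun v => ?_) δ hδ
  · exact mem_kLocus_iff.1 (mem_kLocus_adjoin_of_relations ev fun H hH => (hiff j hj H).1 hH) G hG
  · exact mem_kLocus_iff.1 (mem_kLocus_adjoin_of_relations ev fun H hH => (hiff j hj H).2 hH) G hG
  · refine (halg v).tower_top_of_subalgebra_le (Algebra.adjoin_mono ?_)
    rintro _ ⟨u, hu, rfl⟩
    rw [Set.mem_singleton_iff, Finset.mem_singleton.1 (hTsub (Finset.mem_coe.1 hu))]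

end Summit.Schanuel.Schanuel.Cruxes.MinimalCounterexampleInAcl.KernelArithmeticSelection

end
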